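import Literature.MathematicalPhysics.QuantumLattice.HubbardNNNHoppingWindowCertificateD4
import Literature.MathematicalPhysics.QuantumLattice.OrbitStateLocalCertificate
import HarnessLib

/-!
# `t–t'` Hubbard model: window certificates with an energy constraint bound space-group-averaged
# correlators in EVERY low-energy eigenvector of every large torus (uniformly in `L`)

Family `hubbard` (topic `MathematicalPhysics/QuantumLattice`). The tree has the translation- and
`D₄`-reduced window ("thermodynamic-limit bootstrap") certificate for the `t–t'` Hubbard model as an
ENERGY statement (`groundEnergy_hubbardTorusTT'_div_ge_of_window_certificate_d4`), and, for the pure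
Hubbard model, as a CORRELATOR statement in the TRACIAL sector ground state
(`re_projState_ge_of_window_certificate_d4_ineq`, HubbardCorrelatorCertificate). This file gives the
correlator statement for the `t–t'` model in the form needed for finite-size tables that must hold
for every ground-state vector of a possibly degenerate level: ONE window identity in `𝔄_{Λ'}` with
an energy-constraint term `κ (u·1 − Γ(incl) E^{tt'}_Φ)` (Wang et al. 2024 §III) and Han's full
square-lattice constraint set (2020 §3: positivity, `F[[H,O]] = 0`, translations and affine `D₄`
maps, `U(1)×U(1)` charges, density) proves, for EVERY `L ≥ 3` with `x ↦ x mod L` injective on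
`thicken Λ' 1`, every filling `2n`, and every unit vector `ψ ∈ szSector (2n) 0` with
`H^{tt'}_L ψ = E ψ`,

  `c − Σₖ ‖aₖ‖ + (Σ_σ μ_σ)(n/L² − ν) + κ (u − E/L²) ≤ Re ω̄_ψ(Γ(ι_{Λ',L}) X)`

(`re_orbitState_ge_of_window_certificate_d4_TT'_ineq`), where `ω̄_ψ` is the vector state of `ψ`
averaged over the orbit of the space-group unitaries `U_w D_γ`, `w ∈ (ℤ/Lℤ)²`, `γ ∈ S` for any
submonoid `S ⊆ D₄` containing the point-group elements used by the certificate
(`spaceGroupUnitary S`; `S = {1}`: translation average, `S = D₄`: full space-group average). By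
`star_dotProduct_sum_spaceGroup_conj_mulVec` this is a bound on `⟨ψ, (L²|S|)⁻¹ Σ_{w,γ} U X U⁻¹ ψ⟩`,
i.e. on the lattice- (and point-group-) averaged correlator in the vector `ψ` itself; with `κ ≥ 0`
it holds for every eigenvector of energy `E ≤ u L²` (`…_of_energy_le`), in particular for every
ground state of the sector given a certified upper bound `u` on the ground-state energy per site
(`…_groundState`). The constants are uniform in `L`: one certificate serves all tori. No new physics
definition; `spaceGroupUnitary` is an abbreviation for `U_w D_γ`.

## References
* J. Wang et al., *Certifying ground-state properties of many-body systems*, PRX 14 (2024) 031006,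
  §III. [cite: WangEtAl2024, §III]
* X. Han, *Quantum many-body bootstrap*, arXiv:2006.06002 (2020), §3. [cite: Han2020Bootstrap, §3]
* H. Xu, C.-M. Chung, M. Qin, U. Schollwöck, S. R. White, S. Zhang, Science 384 (2024) eadh7691,
  eq. (1) (the `t–t'` Hubbard model). [cite: XuEtAl2024, eq. (1)]
* O. Bratteli, D. W. Robinson, *Operator Algebras and Quantum Statistical Mechanics II*, §6.2.4.
  [cite: BratteliRobinsonII1997, §6.2.4]
-/

noncomputable section

namespace Literature.MathematicalPhysics.QuantumLattice

open Matrix Finset HubbardWave0 Literature.Probability.LatticeModels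
open Literature.MathematicalPhysics.QuantumManyBody.StateRelaxation
open scoped ComplexOrder BigOperators

/-! ### The space-group orbit family `U_w D_γ` -/

section SpaceGroup

variable {L : ℕ} [NeZero L]

/-- (Local to this section, as in `HubbardWindowCertificateD4`.) [folklore] -/
local instance (priority := high) instDecidableEqFermionTorusCorrTT : DecidableEq (FermionTorus 2 L) :=
  LinearOrder.toDecidableEq

/-- **`D₄` and translations generate the space group**: `D_γ T_v = T_{γ v} D_γ` as orbital
permutations. [cite: Han2020Bootstrap, §3] -/
theorem Orb.d4Perm_mul_translate (γ : DihedralGroup 4) (v : TorusSite 2 L) :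
    Orb.d4Perm (L := L) γ * Orb.translate v = Orb.translate (d4Site γ v) * Orb.d4Perm γ := by
  ext o : 1
  obtain ⟨x, σ, rfl⟩ : ∃ x : TorusSite 2 L, ∃ σ : Fin 2, o = orb (FermionTorus.ofTorusSite x) σ :=
    ⟨FermionTorus.toTorusSite (ofLex o).1, (ofLex o).2, by rw [FermionTorus.ofTorusSite_toTorusSite]; rfl⟩
  rw [Equiv.Perm.mul_apply, Equiv.Perm.mul_apply, Orb.translate_orb, Orb.d4Perm_orb, Orb.d4Perm_orb,
    Orb.translate_orb, d4Site_add]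

/-- `D_γ U_v = U_{γ v} D_γ` for the Fock-space unitaries. [cite: Han2020Bootstrap, §3] -/
theorem fockD4_val_mul_fockTranslate_val (γ : DihedralGroup 4) (v : TorusSite 2 L) :
    (fockD4 (L := L) γ).val * (fockTranslate v).val = (fockTranslate (d4Site γ v)).val * (fockD4 (L := L) γ).val := by
  have h : fockD4 (L := L) γ * fockTranslate v = fockTranslate (d4Site γ v) * fockD4 (L := L) γ := by
    rw [fockD4_apply, ← map_mul, Orb.d4Perm_mul_translate, map_mul]
  exact congrArg Subtype.val h

/-- **The space-group unitaries `U_w D_γ`** (`w ∈ (ℤ/Lℤ)²`, `γ` in a finite set `S ⊆ D₄`), as a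
family indexed by `(ℤ/Lℤ)² × S` — the orbit over which vector states are averaged.
[cite: BratteliRobinsonII1997, §6.2.4] -/
def spaceGroupUnitary (S : Finset (DihedralGroup 4)) :
    TorusSite 2 L × ↥S → Matrix (Finset (Orb (FermionTorus 2 L))) (Finset (Orb (FermionTorus 2 L))) ℂ :=
  fun g => (fockTranslate g.1).val * (fockD4 (L := L) (g.2 : DihedralGroup 4)).val

/-- Unfolding `spaceGroupUnitary`. [folklore] -/
private theorem spaceGroupUnitary_apply (S : Finset (DihedralGroup 4)) (g : TorusSite 2 L × ↥S) :
    spaceGroupUnitary S g = (fockTranslate g.1).val * (fockD4 (L := L) (g.2 : DihedralGroup 4)).val := rfl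

/-- **Closure of the orbit family under an affine `D₄` map**: for `S` closed under multiplication and
`γ₀ ∈ S`, right multiplication by `U_{w₀} D_{γ₀}` permutes the family `(U_w D_γ)_{w, γ ∈ S}`
(`U_w D_γ U_{w₀} D_{γ₀} = U_{w + γ w₀} D_{γ γ₀}`). [cite: Han2020Bootstrap, §3] -/
theorem spaceGroupUnitary_closed {S : Finset (DihedralGroup 4)} (hmul : ∀ a ∈ S, ∀ b ∈ S, a * b ∈ S)
    (w₀ : TorusSite 2 L) {γ₀ : DihedralGroup 4} (hγ₀ : γ₀ ∈ S) :
    ∃ σ : (TorusSite 2 L × ↥S) ≃ (TorusSite 2 L × ↥S), ∀ g,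
      spaceGroupUnitary S g * ((fockTranslate w₀).val * (fockD4 (L := L) γ₀).val) =
        spaceGroupUnitary S (σ g) := by
  let f : TorusSite 2 L × ↥S → TorusSite 2 L × ↥S := fun g =>
    (g.1 + d4Site (g.2 : DihedralGroup 4) w₀, ⟨(g.2 : DihedralGroup 4) * γ₀, hmul _ g.2.2 _ hγ₀⟩)
  have hf : Function.Injective f := by
    rintro ⟨w, γ, hγ⟩ ⟨w', γ', hγ'⟩ h
    simp only [f, Prod.mk.injEq, Subtype.mk.injEq] at h
    obtain ⟨h1, h2⟩ := h
    have hγγ : γ = γ' := mul_right_cancel h2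
    subst hγγ
    have hw : w = w' := add_right_cancel h1
    subst hw
    rfl
  refine ⟨Equiv.ofBijective f (Finite.injective_iff_bijective.mp hf), fun g => ?_⟩
  rw [Equiv.ofBijective_apply, spaceGroupUnitary_apply, spaceGroupUnitary_apply]
  show (fockTranslate g.1).val * (fockD4 (L := L) (g.2 : DihedralGroup 4)).val *
      ((fockTranslate w₀).val * (fockD4 (L := L) γ₀).val) =
    (fockTranslate (g.1 + d4Site (g.2 : DihedralGroup 4) w₀)).val *
      (fockD4 (L := L) ((g.2 : DihedralGroup 4) * γ₀)).val
  rw [fockTranslate_add, map_mul]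
  show _ = (fockTranslate g.1).val * (fockTranslate (d4Site (g.2 : DihedralGroup 4) w₀)).val *
      ((fockD4 (L := L) (g.2 : DihedralGroup 4)).val * (fockD4 (L := L) γ₀).val)
  rw [Matrix.mul_assoc, ← Matrix.mul_assoc (fockD4 (L := L) (g.2 : DihedralGroup 4)).val,
    fockD4_val_mul_fockTranslate_val]
  simp only [Matrix.mul_assoc]

/-- Closure under translations (`1 ∈ S`). [cite: Han2020Bootstrap, §3] -/
theorem spaceGroupUnitary_closed_translate {S : Finset (DihedralGroup 4)} (h1 : (1 : DihedralGroup 4) ∈ S)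
    (hmul : ∀ a ∈ S, ∀ b ∈ S, a * b ∈ S) (v : TorusSite 2 L) :
    ∃ σ : (TorusSite 2 L × ↥S) ≃ (TorusSite 2 L × ↥S), ∀ g,
      spaceGroupUnitary S g * (fockTranslate v).val = spaceGroupUnitary S (σ g) := by
  obtain ⟨σ, hσ⟩ := spaceGroupUnitary_closed (L := L) hmul v h1
  refine ⟨σ, fun g => ?_⟩
  have h := hσ g
  rwa [map_one, show ((1 : Matrix.unitaryGroup (Finset (Orb (FermionTorus 2 L))) ℂ).val :
    Matrix (Finset (Orb (FermionTorus 2 L))) (Finset (Orb (FermionTorus 2 L))) ℂ) = 1 from rfl,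
    Matrix.mul_one] at h

/-- `U_w D_γ` commutes with the `t–t'` Hamiltonian. [cite: XuEtAl2024, eq. (1)] -/
theorem spaceGroupUnitary_mul_hubbardTorusTT' (S : Finset (DihedralGroup 4)) (t t' U : ℝ)
    (g : TorusSite 2 L × ↥S) :
    spaceGroupUnitary S g * hubbardTorusTT' L t t' U = hubbardTorusTT' L t t' U * spaceGroupUnitary S g :=
  d4Affine_mul_hubbardTorusTT' _ _ t t' U

/-- `(U_w D_γ)ᴴ (U_w D_γ) = 1`. [folklore] -/
private theorem spaceGroupUnitary_conjTranspose_mul_self (S : Finset (DihedralGroup 4))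
    (g : TorusSite 2 L × ↥S) : (spaceGroupUnitary S g)ᴴ * spaceGroupUnitary S g = 1 :=
  d4Affine_conjTranspose_mul_self _ _

/-- `(U_w D_γ)ᴴ` preserves the joint sectors. [folklore] -/
private theorem spaceGroupUnitary_conjTranspose_mulVec_mem_szSector (S : Finset (DihedralGroup 4))
    (g : TorusSite 2 L × ↥S) {N : ℕ} {M : ℝ} {ψ : Fock (Orb (FermionTorus 2 L))}
    (hψ : ψ ∈ szSector N M) : (spaceGroupUnitary S g)ᴴ *ᵥ ψ ∈ szSector N M :=
  d4Affine_conjTranspose_mulVec_mem_szSector _ _ hψ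

/-- **The orbit state over `U_w D_γ` evaluates the space-group average in the vector itself**:
`⟨ψ, Σ_{w, γ ∈ S} (U_w D_γ) X (U_w D_γ)ᴴ ψ⟩ = L²·|S| · ω̄_ψ(X)`. [cite: BratteliRobinsonII1997, §6.2.4] -/
theorem star_dotProduct_sum_spaceGroup_conj_mulVec {S : Finset (DihedralGroup 4)}
    (h1 : (1 : DihedralGroup 4) ∈ S) (ψ : Fock (Orb (FermionTorus 2 L)))
    (X : Matrix (Finset (Orb (FermionTorus 2 L))) (Finset (Orb (FermionTorus 2 L))) ℂ) :
    star ψ ⬝ᵥ ((∑ g : TorusSite 2 L × ↥S, spaceGroupUnitary S g * X * (spaceGroupUnitary S g)ᴴ) *ᵥ ψ) =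
      ((L ^ 2 * S.card : ℕ) : ℂ) * orbitState (spaceGroupUnitary S) ψ X := by
  haveI : Nonempty ↥S := ⟨⟨1, h1⟩⟩
  rw [← QuantumManyBody.StateRelaxation.vectorState_apply, vectorState_sum_conj_eq_card_mul_orbitState,
    Fintype.card_prod, card_torusSite, Fintype.card_coe]

end SpaceGroup

/-! ### The torus theorem: a local certificate read in the orbit state of an eigenvector -/

section Torus

variable {L : ℕ} [NeZero L]

/-- (Local to this section, as in `HubbardWindowCertificateD4`.) [folklore] -/
local instance (priority := high) instDecidableEqFermionTorusCorrTT' : DecidableEq (FermionTorus 2 L) :=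
  LinearOrder.toDecidableEq

/-- **Certificate with an energy constraint ⇒ space-group-averaged expectation of a local observable
in EVERY eigenvector of the `t–t'` torus.** Let `H = hubbardTorusTT' L t t' U`, `K = szSector (2n) 0`,
`ψ ∈ K` a unit vector with `H ψ = E ψ`, `S ⊆ D₄` a finite set containing `1` and closed under
multiplication, `ω̄_ψ` the orbit state over `(U_w D_γ)_{w, γ ∈ S}`. Suppose the translates of a local
energy `E_loc` sum to `H`, those of observables `Dᵢ` to operators `Gᵢ = gᵢ` on `K`, and the torus
algebra carries the identity
`X − c·1 − Σᵢ μᵢ (Dᵢ − νᵢ·1) − κ (u·1 − E_loc) = Σ Λₐᵦ Oₐᴴ O_b + (Σₖ (H Xₖ − Xₖ H)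
  + Σₗ (U_{wₗ} D_{γₗ} Yₗ (U_{wₗ} D_{γₗ})ᴴ − Yₗ) + Σᵣ (Zᵣ (Qᵣ − qᵣ) + (Qᵣ − qᵣ) Z'ᵣ) + Σⱼ (Cⱼ Wⱼ − Wⱼ Cⱼ))
  + (Σₘ dₘ • (Vₘᴴ − Vₘ) + Σₖ aₖ • Mₖ)`
with `Λ ⪰ 0`, `γₗ ∈ S`, Hermitian `Qᵣ = qᵣ`, `Cⱼ = q'ⱼ` on `K` (reals), real `dₘ`, contractions `Mₖ`.
Then `c − Σₖ ‖aₖ‖ + Σᵢ μᵢ (gᵢ/L² − νᵢ) + κ (u − E/L²) ≤ Re ω̄_ψ(X)`. Wang et al. 2024 §III with Han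
2020 §3, read in the symmetrised state of an arbitrary eigenvector. [cite: WangEtAl2024, §III] -/
theorem hubbardTorusTT'_re_orbitState_ge_of_local_certificate_ineq (t t' U : ℝ) {nh : ℕ}
    {S : Finset (DihedralGroup 4)} (h1 : (1 : DihedralGroup 4) ∈ S) (hmul : ∀ a ∈ S, ∀ b ∈ S, a * b ∈ S)
    {ψ : Fock (Orb (FermionTorus 2 L))}
    (hψK : ψ ∈ (szSector (2 * nh) 0 : Submodule ℂ (Fock (Orb (FermionTorus 2 L)))))
    (hψ1 : star ψ ⬝ᵥ ψ = 1) {E : ℝ} (hHψ : hubbardTorusTT' L t t' U *ᵥ ψ = (E : ℂ) • ψ)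
    (X Eloc : Matrix (Finset (Orb (FermionTorus 2 L))) (Finset (Orb (FermionTorus 2 L))) ℂ)
    (hE : ∑ v : TorusSite 2 L, (fockTranslate v).val * Eloc * (fockTranslate v).valᴴ =
      hubbardTorusTT' L t t' U) (κ u : ℝ)
    {δ' : Type*} (dens : Finset δ') (μ ν g : δ' → ℝ)
    (D G : δ' → Matrix (Finset (Orb (FermionTorus 2 L))) (Finset (Orb (FermionTorus 2 L))) ℂ)
    (hD : ∀ i ∈ dens, ∑ v : TorusSite 2 L, (fockTranslate v).val * D i * (fockTranslate v).valᴴ = G i)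
    (hG : ∀ i ∈ dens, ∀ φ ∈ (szSector (2 * nh) 0 : Submodule ℂ (Fock (Orb (FermionTorus 2 L)))),
      G i *ᵥ φ = ((g i : ℝ) : ℂ) • φ)
    {m : Type*} [Fintype m] [DecidableEq m] {Λm : Matrix m m ℂ} (hΛ : Λm.PosSemidef)
    (O : m → Matrix (Finset (Orb (FermionTorus 2 L))) (Finset (Orb (FermionTorus 2 L))) ℂ)
    {κ' : Type*} (s : Finset κ')
    (Xc : κ' → Matrix (Finset (Orb (FermionTorus 2 L))) (Finset (Orb (FermionTorus 2 L))) ℂ)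
    {ι : Type*} (tt : Finset ι) (γ : ι → DihedralGroup 4) (hγS : ∀ l ∈ tt, γ l ∈ S)
    (wv : ι → TorusSite 2 L)
    (Y : ι → Matrix (Finset (Orb (FermionTorus 2 L))) (Finset (Orb (FermionTorus 2 L))) ℂ)
    {ρ : Type*} (r : Finset ρ)
    (Q Z Z' : ρ → Matrix (Finset (Orb (FermionTorus 2 L))) (Finset (Orb (FermionTorus 2 L))) ℂ)
    (q : ρ → ℝ) (hQh : ∀ i ∈ r, (Q i).IsHermitian)
    (hQ : ∀ i ∈ r, ∀ φ ∈ (szSector (2 * nh) 0 : Submodule ℂ (Fock (Orb (FermionTorus 2 L)))),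
      Q i *ᵥ φ = ((q i : ℝ) : ℂ) • φ)
    {γ' : Type*} (u' : Finset γ')
    (C W : γ' → Matrix (Finset (Orb (FermionTorus 2 L))) (Finset (Orb (FermionTorus 2 L))) ℂ)
    (qc : γ' → ℝ) (hCh : ∀ j ∈ u', (C j).IsHermitian)
    (hC : ∀ j ∈ u', ∀ φ ∈ (szSector (2 * nh) 0 : Submodule ℂ (Fock (Orb (FermionTorus 2 L)))),
      C j *ᵥ φ = ((qc j : ℝ) : ℂ) • φ)
    {δ : Type*} (ah : Finset δ) (dc : δ → ℝ)
    (V : δ → Matrix (Finset (Orb (FermionTorus 2 L))) (Finset (Orb (FermionTorus 2 L))) ℂ)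
    {κ'' : Type*} (w : Finset κ'') (a : κ'' → ℂ)
    (M : κ'' → Matrix (Finset (Orb (FermionTorus 2 L))) (Finset (Orb (FermionTorus 2 L))) ℂ)
    (hM : ∀ k ∈ w, (M k).IsContraction) {c : ℝ}
    (hcert : X - (c : ℂ) • (1 : Matrix (Finset (Orb (FermionTorus 2 L))) (Finset (Orb (FermionTorus 2 L))) ℂ) -
        ∑ i ∈ dens, ((μ i : ℝ) : ℂ) • (D i - ((ν i : ℝ) : ℂ) •
          (1 : Matrix (Finset (Orb (FermionTorus 2 L))) (Finset (Orb (FermionTorus 2 L))) ℂ)) -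
        ((κ : ℝ) : ℂ) • (((u : ℝ) : ℂ) •
          (1 : Matrix (Finset (Orb (FermionTorus 2 L))) (Finset (Orb (FermionTorus 2 L))) ℂ) - Eloc) =
      gramForm Λm O +
        (∑ k ∈ s, (hubbardTorusTT' L t t' U * Xc k - Xc k * hubbardTorusTT' L t t' U) +
          ∑ l ∈ tt, ((fockTranslate (wv l)).val * (fockD4 (L := L) (γ l)).val * Y l *
              ((fockTranslate (wv l)).val * (fockD4 (L := L) (γ l)).val)ᴴ - Y l) +
          ∑ i ∈ r, (Z i * (Q i - ((q i : ℝ) : ℂ) • 1) + (Q i - ((q i : ℝ) : ℂ) • 1) * Z' i) +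
          ∑ j ∈ u', (C j * W j - W j * C j)) +
        (∑ m' ∈ ah, ((dc m' : ℝ) : ℂ) • ((V m')ᴴ - V m') + ∑ k ∈ w, a k • M k)) :
    c - ∑ k ∈ w, ‖a k‖ + ∑ i ∈ dens, μ i * (g i / (L : ℝ) ^ 2 - ν i) + κ * (u - E / (L : ℝ) ^ 2) ≤
      (orbitState (spaceGroupUnitary S) ψ X).re := by
  haveI : Nonempty ↥S := ⟨⟨1, h1⟩⟩
  have hA : (hubbardTorusTT' L t t' U).IsHermitian := hubbardTorusTT'_isHermitian L t t' U
  have h := re_orbitState_ge_of_local_certificate_ineq hA (szSector (2 * nh) 0) hψK hψ1 hHψ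
    (spaceGroupUnitary S) (fun g' => spaceGroupUnitary_mul_hubbardTorusTT' S t t' U g')
    (fun g' => spaceGroupUnitary_conjTranspose_mul_self S g')
    (fun g' φ hφ => spaceGroupUnitary_conjTranspose_mulVec_mem_szSector S g' hφ)
    (fun v => (fockTranslate v).val) (fun v => spaceGroupUnitary_closed_translate h1 hmul v)
    X Eloc hE κ u dens μ ν g D G hD hG hΛ O s Xc tt
    (fun l => (fockTranslate (wv l)).val * (fockD4 (L := L) (γ l)).val) Y
    (fun l hl => spaceGroupUnitary_closed hmul (wv l) (hγS l hl))
    r Q Z Z' q hQh hQ u' C W qc hCh hC ah dc V w a M hM hcert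
  rw [card_torusSite] at h
  push_cast at h
  exact h

/-- **With the energy hypothesis**: `κ ≥ 0` and `E/L² ≤ u` give
`c − Σₖ ‖aₖ‖ + Σᵢ μᵢ (gᵢ/L² − νᵢ) ≤ Re ω̄_ψ(X)` for every such eigenvector — the eigenvector is
feasible for the energy constraint, Wang et al. 2024 §III. [cite: WangEtAl2024, §III] -/
theorem hubbardTorusTT'_re_orbitState_ge_of_local_certificate_ineq_of_energy_le (t t' U : ℝ) {nh : ℕ}
    {S : Finset (DihedralGroup 4)} (h1 : (1 : DihedralGroup 4) ∈ S) (hmul : ∀ a ∈ S, ∀ b ∈ S, a * b ∈ S)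
    {ψ : Fock (Orb (FermionTorus 2 L))}
    (hψK : ψ ∈ (szSector (2 * nh) 0 : Submodule ℂ (Fock (Orb (FermionTorus 2 L)))))
    (hψ1 : star ψ ⬝ᵥ ψ = 1) {E : ℝ} (hHψ : hubbardTorusTT' L t t' U *ᵥ ψ = (E : ℂ) • ψ)
    (X Eloc : Matrix (Finset (Orb (FermionTorus 2 L))) (Finset (Orb (FermionTorus 2 L))) ℂ)
    (hE : ∑ v : TorusSite 2 L, (fockTranslate v).val * Eloc * (fockTranslate v).valᴴ =
      hubbardTorusTT' L t t' U) {κ u : ℝ} (hκ : 0 ≤ κ) (hu : E / (L : ℝ) ^ 2 ≤ u)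
    {δ' : Type*} (dens : Finset δ') (μ ν g : δ' → ℝ)
    (D G : δ' → Matrix (Finset (Orb (FermionTorus 2 L))) (Finset (Orb (FermionTorus 2 L))) ℂ)
    (hD : ∀ i ∈ dens, ∑ v : TorusSite 2 L, (fockTranslate v).val * D i * (fockTranslate v).valᴴ = G i)
    (hG : ∀ i ∈ dens, ∀ φ ∈ (szSector (2 * nh) 0 : Submodule ℂ (Fock (Orb (FermionTorus 2 L)))),
      G i *ᵥ φ = ((g i : ℝ) : ℂ) • φ)
    {m : Type*} [Fintype m] [DecidableEq m] {Λm : Matrix m m ℂ} (hΛ : Λm.PosSemidef)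
    (O : m → Matrix (Finset (Orb (FermionTorus 2 L))) (Finset (Orb (FermionTorus 2 L))) ℂ)
    {κ' : Type*} (s : Finset κ')
    (Xc : κ' → Matrix (Finset (Orb (FermionTorus 2 L))) (Finset (Orb (FermionTorus 2 L))) ℂ)
    {ι : Type*} (tt : Finset ι) (γ : ι → DihedralGroup 4) (hγS : ∀ l ∈ tt, γ l ∈ S)
    (wv : ι → TorusSite 2 L)
    (Y : ι → Matrix (Finset (Orb (FermionTorus 2 L))) (Finset (Orb (FermionTorus 2 L))) ℂ)
    {ρ : Type*} (r : Finset ρ)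
    (Q Z Z' : ρ → Matrix (Finset (Orb (FermionTorus 2 L))) (Finset (Orb (FermionTorus 2 L))) ℂ)
    (q : ρ → ℝ) (hQh : ∀ i ∈ r, (Q i).IsHermitian)
    (hQ : ∀ i ∈ r, ∀ φ ∈ (szSector (2 * nh) 0 : Submodule ℂ (Fock (Orb (FermionTorus 2 L)))),
      Q i *ᵥ φ = ((q i : ℝ) : ℂ) • φ)
    {γ' : Type*} (u' : Finset γ')
    (C W : γ' → Matrix (Finset (Orb (FermionTorus 2 L))) (Finset (Orb (FermionTorus 2 L))) ℂ)
    (qc : γ' → ℝ) (hCh : ∀ j ∈ u', (C j).IsHermitian)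
    (hC : ∀ j ∈ u', ∀ φ ∈ (szSector (2 * nh) 0 : Submodule ℂ (Fock (Orb (FermionTorus 2 L)))),
      C j *ᵥ φ = ((qc j : ℝ) : ℂ) • φ)
    {δ : Type*} (ah : Finset δ) (dc : δ → ℝ)
    (V : δ → Matrix (Finset (Orb (FermionTorus 2 L))) (Finset (Orb (FermionTorus 2 L))) ℂ)
    {κ'' : Type*} (w : Finset κ'') (a : κ'' → ℂ)
    (M : κ'' → Matrix (Finset (Orb (FermionTorus 2 L))) (Finset (Orb (FermionTorus 2 L))) ℂ)
    (hM : ∀ k ∈ w, (M k).IsContraction) {c : ℝ}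
    (hcert : X - (c : ℂ) • (1 : Matrix (Finset (Orb (FermionTorus 2 L))) (Finset (Orb (FermionTorus 2 L))) ℂ) -
        ∑ i ∈ dens, ((μ i : ℝ) : ℂ) • (D i - ((ν i : ℝ) : ℂ) •
          (1 : Matrix (Finset (Orb (FermionTorus 2 L))) (Finset (Orb (FermionTorus 2 L))) ℂ)) -
        ((κ : ℝ) : ℂ) • (((u : ℝ) : ℂ) •
          (1 : Matrix (Finset (Orb (FermionTorus 2 L))) (Finset (Orb (FermionTorus 2 L))) ℂ) - Eloc) =
      gramForm Λm O +
        (∑ k ∈ s, (hubbardTorusTT' L t t' U * Xc k - Xc k * hubbardTorusTT' L t t' U) +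
          ∑ l ∈ tt, ((fockTranslate (wv l)).val * (fockD4 (L := L) (γ l)).val * Y l *
              ((fockTranslate (wv l)).val * (fockD4 (L := L) (γ l)).val)ᴴ - Y l) +
          ∑ i ∈ r, (Z i * (Q i - ((q i : ℝ) : ℂ) • 1) + (Q i - ((q i : ℝ) : ℂ) • 1) * Z' i) +
          ∑ j ∈ u', (C j * W j - W j * C j)) +
        (∑ m' ∈ ah, ((dc m' : ℝ) : ℂ) • ((V m')ᴴ - V m') + ∑ k ∈ w, a k • M k)) :
    c - ∑ k ∈ w, ‖a k‖ + ∑ i ∈ dens, μ i * (g i / (L : ℝ) ^ 2 - ν i) ≤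
      (orbitState (spaceGroupUnitary S) ψ X).re := by
  have h := hubbardTorusTT'_re_orbitState_ge_of_local_certificate_ineq t t' U h1 hmul hψK hψ1 hHψ X Eloc
    hE κ u dens μ ν g D G hD hG hΛ O s Xc tt γ hγS wv Y r Q Z Z' q hQh hQ u' C W qc hCh hC ah dc V w a M
    hM hcert
  have hslack : 0 ≤ κ * (u - E / (L : ℝ) ^ 2) := mul_nonneg hκ (sub_nonneg.2 hu)
  linarith

end Torus

end Literature.MathematicalPhysics.QuantumLattice

end
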